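import Literature.Computability.Cryptography.VanDamSeroussiOracle
import Literature.Computability.Complexity.CodeFPModArith
import Literature.Computability.Complexity.CodeFPStrings
import Literature.Computability.Complexity.CodeFPLists
import Literature.Computability.Complexity.FoldCatBricks
import Literature.Computability.Complexity.StackWords
import Literature.Computability.Complexity.QuadraticCongruencesFactMachine
import HarnessLib

/-!
# The classical oracle of the van Dam–Seroussi circuit, II: the polynomial-time parts

Topic `Literature/Computability/Cryptography`, sequel of `VanDamSeroussiOracle.lean` (the query
format `VDSOracle.encodeQ`, its total parser `VDSOracle.parse`, the value `VDSOracle.valOf` and the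
answer bit `VDSOracle.specBit` of the ONE oracle language of the circuit). This file proves, in the
tree's typed algebra of polynomial-time maps on codes (`Complexity.CodeFP`, Arora–Barak 2009,
§1.2–1.3), that everything CLASSICAL about that language is polynomial time:

* `codeFP_parse` — the parser, and the accessors of a query;
* `codeFP_valOfP` — the value of every arithmetic tag (state preparation, periodisation, division
  step, phase digits; van Dam–Seroussi 2002, §4 Algorithm 1 with Hales 2002, Ch. 5 §1 Algorithm 3);
  the discrete-logarithm tag is answered `0` here (it is the quantum subroutine's business);
* `codeFP_certOK` — the primitive-root certificate check (primality by the tree's `primeFn`,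
  the product of the certified primes, one modular exponentiation per prime; Shor 1997, §6);
* `codeFP_parseF` — reading the certificate register;
* the CLASSICAL POST-PROCESSING of the two quantum subroutines: `dlogAny` (scan the prefixes of the
  discrete-logarithm solver's output for the unique exponent that verifies, and read its bit —
  the device of `ShorAssembly.orderFromPrefix`, since `bin d` is not self-delimiting) with
  `codeFP_dlogAny` and **`dlogAny_eq_testBit_dlog`**; the factoring answer
  `bit idx of certCode (parseF out)` with `codeFP_factBit` (the factor list IS self-delimiting).

Everything is proved; no definition, no named fact.

## References

* W. van Dam, G. Seroussi, arXiv:quant-ph/0207131 (2002), §3 Lemma 1, §4 Algorithm 1 [VanDamSeroussi2002].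
* P. W. Shor, SIAM J. Comput. 26 (1997), §5–§6 [Shor1997].
* S. Arora, B. Barak, *Computational Complexity: A Modern Approach*, CUP 2009, §1.2–1.3 [AroraBarak2009].
-/

noncomputable section

namespace Literature.Computability.Cryptography

namespace VDSOracle

open _root_.Computability Complexity Complexity.Brick Complexity.CodeFP Complexity.ModArith
open Hales2002 (kOf near rOff)

/-- **The code of a parsed query** (the typed view of a query used by the polynomial-time algebra):
binary `p, g, a, b`, unary tag, binary index, unary `L`, unary `w₁`, then the raw registers.
[cite: AroraBarak2009, §1.2 (representation of tuples)] -/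
def Query.code (q : Query) : List Bool :=
  pairE natE (pairE natE (pairE natE (pairE natE (pairE unE (pairE natE (pairE unE (pairE unE strE)))))))
    (q.p, q.g, q.a, q.b, q.tag, q.idx, q.L, q.w₁, q.regs)

/-- Unfolding the code of a query. [folklore] -/
theorem Query.code_eq (q : Query) : q.code =
    boolPair (natE q.p) (boolPair (natE q.g) (boolPair (natE q.a) (boolPair (natE q.b) (boolPair (unE q.tag)
      (boolPair (natE q.idx) (boolPair (unE q.L) (boolPair (unE q.w₁) q.regs))))))) := rfl

/-! ### The parser and the accessors -/

/-- `fstF` on strings (a one-liner also present, in unrelated import cones, as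
`Barriers/QuantumAdvantage/…fstF_code`; kept private here). [folklore] -/
private theorem codeFP_fstF : CodeFP strE strE fstF := ⟨fstF, fstF_mem_FP, fun _ => rfl⟩

/-- `sndF` on strings (likewise `SumcheckIP.sndC`). [folklore] -/
private theorem codeFP_sndF : CodeFP strE strE sndF := ⟨sndF, sndF_mem_FP, fun _ => rfl⟩

/-- **The parser is polynomial time.** [cite: AroraBarak2009, §1.3] -/
theorem codeFP_parse : CodeFP strE Query.code parse := by
  have hx : CodeFP strE strE (fun w => fstF w) := codeFP_fstF
  have hr : CodeFP strE strE (fun w => sndF w) := codeFP_sndF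
  have hp : CodeFP strE natE (fun w => bitsToNat (fstF (fstF w))) := strVal.comp (codeFP_fstF.comp hx)
  have hg : CodeFP strE natE (fun w => bitsToNat (fstF (sndF (fstF w)))) := strVal.comp (codeFP_fstF.comp (codeFP_sndF.comp hx))
  have ha : CodeFP strE natE (fun w => bitsToNat (fstF (sndF (sndF (fstF w))))) :=
    strVal.comp (codeFP_fstF.comp (codeFP_sndF.comp (codeFP_sndF.comp hx)))
  have hb : CodeFP strE natE (fun w => bitsToNat (sndF (sndF (sndF (fstF w))))) :=
    strVal.comp (codeFP_sndF.comp (codeFP_sndF.comp (codeFP_sndF.comp hx)))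
  have ht : CodeFP strE unE (fun w => (fstF (sndF w)).length) := strLength.comp (codeFP_fstF.comp hr)
  have hi : CodeFP strE natE (fun w => bitsToNat (fstF (sndF (sndF w)))) := strVal.comp (codeFP_fstF.comp (codeFP_sndF.comp hr))
  have hL : CodeFP strE unE (fun w => (fstF (sndF (sndF (sndF w)))).length) :=
    strLength.comp (codeFP_fstF.comp (codeFP_sndF.comp (codeFP_sndF.comp hr)))
  have hw : CodeFP strE unE (fun w => (fstF (sndF (sndF (sndF (sndF w))))).length) :=
    strLength.comp (codeFP_fstF.comp (codeFP_sndF.comp (codeFP_sndF.comp (codeFP_sndF.comp hr))))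
  have hs : CodeFP strE strE (fun w => sndF (sndF (sndF (sndF (sndF w))))) :=
    codeFP_sndF.comp (codeFP_sndF.comp (codeFP_sndF.comp (codeFP_sndF.comp hr)))
  obtain ⟨f, hf, hfw⟩ := hp.pair (hg.pair (ha.pair (hb.pair (ht.pair (hi.pair (hL.pair (hw.pair hs)))))))
  exact ⟨f, hf, fun w => (hfw w).trans rfl⟩

/-- The accessors of a query are polynomial time. [folklore] -/
theorem codeFP_fields :
    CodeFP Query.code natE Query.p ∧ CodeFP Query.code natE Query.g ∧ CodeFP Query.code natE Query.a ∧ CodeFP Query.code natE Query.b ∧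
      CodeFP Query.code unE Query.tag ∧ CodeFP Query.code natE Query.idx ∧ CodeFP Query.code unE Query.L ∧ CodeFP Query.code unE Query.w₁ ∧
      CodeFP Query.code strE Query.regs := by
  refine ⟨⟨nthF 0, nthF_mem_FP 0, fun q => ?_⟩, ⟨nthF 1, nthF_mem_FP 1, fun q => ?_⟩, ⟨nthF 2, nthF_mem_FP 2, fun q => ?_⟩,
    ⟨nthF 3, nthF_mem_FP 3, fun q => ?_⟩, ⟨nthF 4, nthF_mem_FP 4, fun q => ?_⟩, ⟨nthF 5, nthF_mem_FP 5, fun q => ?_⟩,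
    ⟨nthF 6, nthF_mem_FP 6, fun q => ?_⟩, ⟨nthF 7, nthF_mem_FP 7, fun q => ?_⟩, ⟨sndPow 7, sndPow_mem_FP 7, fun q => ?_⟩⟩ <;>
  simp [nthF, sndPow, Query.code_eq]

/-- The registers of a query are polynomial time. [folklore] -/
theorem codeFP_regs : CodeFP Query.code strE Query.r1 ∧ CodeFP Query.code strE Query.r2 := by
  obtain ⟨-, -, -, -, -, -, -, hw, hs⟩ := codeFP_fields
  exact ⟨(strTake.comp (hw.pair hs)).congr fun _ => rfl, (strDrop.comp (hw.pair hs)).congr fun _ => rfl⟩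

/-- Branching on the tag. [folklore] -/
theorem codeFP_iteTag {β : Type} {eβ : β → List Bool} (k : ℕ) {g h : Query → β} (hg : CodeFP Query.code eβ g)
    (hh : CodeFP Query.code eβ h) : CodeFP Query.code eβ (fun q => if q.tag = k then g q else h q) := by
  obtain ⟨-, -, -, -, ht, -⟩ := codeFP_fields
  refine (((eq unE_injective).comp (ht.pair (const _ k))).ite hg hh).congr fun q => ?_
  by_cases hq : q.tag = k
  · simp [hq]
  · simp [hq]

/-! ### The arithmetic tags -/

/-- **The value of the arithmetic tags is polynomial time**: `valOf` with the discrete-logarithm tag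
answered `0`. [cite: VanDamSeroussi2002, §4 Algorithm 1] [cite: Hales2002, Ch. 5 §1 Algorithm 3] -/
theorem codeFP_valOfP : CodeFP Query.code natE (fun q => if q.tag = tagDLOG then 0 else valOf q) := by
  obtain ⟨hp, -, ha, -, -, -, hL, hw, -⟩ := codeFP_fields
  obtain ⟨hr1, hr2⟩ := codeFP_regs
  have hv1 : CodeFP Query.code natE (fun q => bitsToNat q.r1) := strVal.comp hr1
  have hv2 : CodeFP Query.code natE (fun q => bitsToNat q.r2) := strVal.comp hr2
  have hpm1 : CodeFP Query.code natE (fun q => q.p - 1) := natSub.comp (hp.pair (const _ 1))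
  have hQ1 : CodeFP Query.code natE (fun q => 2 ^ q.w₁) := natPow.comp ((const _ 2).pair hw)
  have hQL : CodeFP Query.code natE (fun q => 2 ^ q.L) := natPow.comp ((const _ 2).pair hL)
  -- state preparation
  have hy : CodeFP Query.code natE (fun q => yOfT q.p (bitsToNat q.r1)) :=
    (natAdd.comp ((const _ 1).pair (natMod.comp (hv1.pair hpm1)))).congr fun _ => rfl
  have hqo : CodeFP Query.code natE (fun q => qOfT q.p (bitsToNat q.r1)) := (natDiv.comp (hv1.pair hpm1)).congr fun _ => rfl
  have hto : CodeFP Query.code natE (fun q => tOfQY q.p (bitsToNat q.r1) (bitsToNat q.r2)) :=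
    (natAdd.comp ((natMul.comp (hv1.pair hpm1)).pair (natSub.comp (hv2.pair (const _ 1))))).congr fun _ => rfl
  -- periodisation
  have ham : CodeFP Query.code natE (fun q => addMul q.p (bitsToNat q.r1) (bitsToNat q.r2)) :=
    (natAdd.comp (hv1.pair (natMul.comp (hp.pair hv2)))).congr fun _ => rfl
  have hmod : CodeFP Query.code natE (fun q => bitsToNat q.r1 % q.p) := natMod.comp (hv1.pair hp)
  have hdiv : CodeFP Query.code natE (fun q => bitsToNat q.r1 / q.p) := natDiv.comp (hv1.pair hp)
  -- division step: `kOf p Q z = (2 z p + Q)/(2 Q) mod p`, `near p Q i = (2 Q i + p)/(2 p)`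
  have hkOfG : ∀ {P Q Z : Query → ℕ}, CodeFP Query.code natE P → CodeFP Query.code natE Q → CodeFP Query.code natE Z →
      CodeFP Query.code natE (fun q => kOf (P q) (Q q) (Z q)) := by
    intro P Q Z hP hQ hZ
    have h2z : CodeFP Query.code natE (fun q => 2 * Z q * P q + Q q) :=
      natAdd.comp ((natMul.comp ((natMul.comp ((const _ 2).pair hZ)).pair hP)).pair hQ)
    have h2Q : CodeFP Query.code natE (fun q => 2 * Q q) := natMul.comp ((const _ 2).pair hQ)
    exact (natMod.comp ((natDiv.comp (h2z.pair h2Q)).pair hP)).congr fun _ => rfl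
  have hnearG : ∀ {P Q I : Query → ℕ}, CodeFP Query.code natE P → CodeFP Query.code natE Q → CodeFP Query.code natE I →
      CodeFP Query.code natE (fun q => near (P q) (Q q) (I q)) := by
    intro P Q I hP hQ hI
    have hnum : CodeFP Query.code natE (fun q => 2 * Q q * I q + P q) := natAdd.comp ((natMul.comp ((natMul.comp ((const _ 2).pair hQ)).pair hI)).pair hP)
    have hden : CodeFP Query.code natE (fun q => 2 * P q) := natMul.comp ((const _ 2).pair hP)
    exact (natDiv.comp (hnum.pair hden)).congr fun _ => rfl
  have hk : CodeFP Query.code natE (fun q => kOf q.p (2 ^ q.w₁) (bitsToNat q.r1)) := hkOfG hp hQ1 hv1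
  have hoff : CodeFP Query.code natE (fun q => rOff q.p (2 ^ q.w₁) (kOf q.p (2 ^ q.w₁) (bitsToNat q.r1)) (bitsToNat q.r1)) := by
    have hn : CodeFP Query.code natE (fun q => near q.p (2 ^ q.w₁) (kOf q.p (2 ^ q.w₁) (bitsToNat q.r1))) := hnearG hp hQ1 hk
    exact (natMod.comp ((natSub.comp ((natAdd.comp (hv1.pair hQ1)).pair hn)).pair hQ1)).congr fun _ => rfl
  have hunz : CodeFP Query.code natE (fun q => unz q.p (2 ^ q.L) (bitsToNat q.r1) (bitsToNat q.r2)) := by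
    have hn : CodeFP Query.code natE (fun q => near q.p (2 ^ q.L) (bitsToNat q.r1)) := hnearG hp hQL hv1
    exact (natMod.comp ((natAdd.comp (hv2.pair hn)).pair hQL)).congr fun _ => rfl
  -- phase digits: `phaseNum p e L d = 2^L (e d mod (p−1)) / (p−1)`, `e = expOf p a (r1.headD false)`
  have hgetD : ∀ l : List Bool, l.getD 0 false = l.headD false := fun l => by cases l <;> simp
  have hhead : CodeFP Query.code bitE (fun q => q.r1.headD false) :=
    (strGetDNat.comp (hr1.pair (const _ 0))).congr fun q => by dsimp only; exact hgetD _
  have hexp : CodeFP Query.code natE (fun q => expOf q.p q.a (q.r1.headD false)) :=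
    (hhead.ite (natDiv.comp (hpm1.pair (const _ 2))) ha).congr fun q => by unfold expOf; rfl
  have hph : CodeFP Query.code natE (fun q => phaseNum q.p (expOf q.p q.a (q.r1.headD false)) q.L (bitsToNat q.r2)) :=
    (natDiv.comp ((natMul.comp (hQL.pair (natMod.comp ((natMul.comp (hexp.pair hv2)).pair hpm1)))).pair hpm1)).congr fun _ => rfl
  -- the tag dispatch (innermost first)
  have h11 : CodeFP Query.code natE (fun q => if q.tag = tagUNZ then unz q.p (2 ^ q.L) (bitsToNat q.r1) (bitsToNat q.r2) else 0) :=
    codeFP_iteTag _ hunz (const _ 0)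
  have h10 := codeFP_iteTag tagOFF hoff h11
  have h9 := codeFP_iteTag tagKOF hk h10
  have h8 := codeFP_iteTag tagDIVP hdiv h9
  have h7 := codeFP_iteTag tagMODP hmod h8
  have h6 := codeFP_iteTag tagADDMUL ham h7
  have h5 := codeFP_iteTag tagTOFQY hto h6
  have h4 := codeFP_iteTag tagQOFT hqo h5
  have h3 := codeFP_iteTag tagYOFT hy h4
  have h2 := codeFP_iteTag tagPHASE hph h3
  have h1 := codeFP_iteTag tagDLOG (const _ 0) h2
  refine h1.congr fun q => ?_
  by_cases hd : q.tag = tagDLOG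
  · rw [if_pos hd, if_pos hd]
  · rw [if_neg hd, if_neg hd, valOf, if_neg hd]

/-! ### The certificate check -/

/-- Primality of a binary numeral is polynomial time (the tree's `primeFn`, Agrawal–Kayal–Saxena
through `PRIMES ∈ P`). [cite: Shor1997, §6] -/
theorem codeFP_prime : CodeFP natE bitE (fun n => decide n.Prime) :=
  ⟨QuadCongNP.primeFn, QuadCongNP.primeFn_mem_FP, fun n => QuadCongFP.primeFn_encodeNat n⟩

/-- Products of lists of binary numerals are polynomial time (the code of a product is at most one bit
longer than the raw code of the list; the same one-liner exists as `SimApproxLLL.prodFP` in the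
Euclidean-lattices cone, not imported here). [folklore] -/
private theorem codeFP_listProd : CodeFP (rawE natE) natE List.prod := by
  have h := foldl₀ (eα := natE) (eβ := natE) (step := fun (a : ℕ) (b : ℕ) => b * a) (b₀ := 1)
    (natMul.comp ((snd _ _).pair (fst _ _))) (Polynomial.X + 1) (fun l₁ l₂ => by
      rw [Polynomial.eval_add, Polynomial.eval_X, Polynomial.eval_one, ← List.prod_eq_foldl]
      refine (length_natE_le_of_lt (prod_lt_two_pow_length_rawE_succ l₁)).trans ?_
      have := length_rawE_le_of_sublist natE (List.sublist_append_left l₁ l₂)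
      omega)
  exact h.congr fun l => by rw [← List.prod_eq_foldl]

/-- **The primitive-root certificate check is polynomial time** (as a Boolean function of `(p, g, F)`).
[cite: Shor1997, §6] -/
theorem codeFP_certOK : CodeFP (pairE natE (pairE natE (rawE natE))) bitE (fun t => decide (CertOK t.1 t.2.1 t.2.2)) := by
  have hP : CodeFP (pairE natE (pairE natE (rawE natE))) natE (fun t => t.1) := fst _ _
  have hG : CodeFP (pairE natE (pairE natE (rawE natE))) natE (fun t => t.2.1) := (snd _ _).fst'
  have hF : CodeFP (pairE natE (pairE natE (rawE natE))) (rawE natE) (fun t => t.2.2) := (snd _ _).snd'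
  have h1 : CodeFP (pairE natE (pairE natE (rawE natE))) bitE (fun t => decide t.1.Prime) := codeFP_prime.comp hP
  have h2 : CodeFP (pairE natE (pairE natE (rawE natE))) bitE (fun t => decide (0 < t.2.1)) := natLt.comp ((const _ 0).pair hG)
  have h3 : CodeFP (pairE natE (pairE natE (rawE natE))) bitE (fun t => decide (t.2.1 < t.1)) := natLt.comp (hG.pair hP)
  have h4 : CodeFP (pairE natE (pairE natE (rawE natE))) bitE (fun t => t.2.2.all fun r => decide r.Prime) :=
    (all (σ := ℕ × (ℕ × List ℕ)) (codeFP_prime.comp (snd _ natE))).comp ((CodeFP.id _).pair hF)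
  have h5 : CodeFP (pairE natE (pairE natE (rawE natE))) bitE (fun t => decide (t.2.2.prod = t.1 - 1)) :=
    natEq.comp ((codeFP_listProd.comp hF).pair (natSub.comp (hP.pair (const _ 1))))
  have h6 : CodeFP (pairE natE (pairE natE (rawE natE))) bitE
      (fun t => t.2.2.all fun r => !decide (powM t.1 t.2.1 ((t.1 - 1) / r) = 1)) := by
    have hitem : CodeFP (pairE (pairE natE (pairE natE (rawE natE))) natE) bitE
        (fun s => !decide (powM s.1.1 s.1.2.1 ((s.1.1 - 1) / s.2) = 1)) := by
      have hp' : CodeFP (pairE (pairE natE (pairE natE (rawE natE))) natE) natE (fun s => s.1.1) := (fst _ _).fst'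
      have hg' : CodeFP (pairE (pairE natE (pairE natE (rawE natE))) natE) natE (fun s => s.1.2.1) := (fst _ _).snd'.fst'
      have hr' : CodeFP (pairE (pairE natE (pairE natE (rawE natE))) natE) natE (fun s => s.2) := snd _ _
      have he : CodeFP (pairE (pairE natE (pairE natE (rawE natE))) natE) natE (fun s => (s.1.1 - 1) / s.2) :=
        natDiv.comp ((natSub.comp (hp'.pair (const _ 1))).pair hr')
      have hpow : CodeFP (pairE (pairE natE (pairE natE (rawE natE))) natE) natE (fun s => powM s.1.1 s.1.2.1 ((s.1.1 - 1) / s.2)) :=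
        modExp.comp (hg'.pair (he.pair hp'))
      exact (natEq.comp (hpow.pair (const _ 1))).not
    exact (all hitem).comp ((CodeFP.id _).pair hF)
  refine ((h1.and h2).and (h3.and (h4.and (h5.and h6)))).congr fun t => ?_
  obtain ⟨p, g, F⟩ := t
  dsimp only
  by_cases hpr : p.Prime
  · have hp2 : 2 ≤ p := hpr.two_le
    have key : ∀ r, (¬ g ^ ((p - 1) / r) ≡ 1 [MOD p]) ↔ (!decide (powM p g ((p - 1) / r) = 1)) = true := by
      intro r
      rw [Bool.not_eq_true', decide_eq_false_iff_not, not_iff_not, powM, if_pos hp2, Nat.ModEq, Nat.mod_eq_of_lt (show 1 < p by omega)]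
    rw [Bool.eq_iff_iff]
    simp only [Bool.and_eq_true, decide_eq_true_eq, List.all_eq_true, CertOK]
    constructor
    · rintro ⟨⟨-, h0⟩, hgp, hall, hprod, hne⟩
      exact ⟨hpr, h0, hgp, hall, hprod, fun r hr => (key r).2 (hne r hr)⟩
    · rintro ⟨-, h0, hgp, hall, hprod, hne⟩
      exact ⟨⟨hpr, h0⟩, hgp, hall, hprod, fun r hr => (key r).1 (hne r hr)⟩
  · have h : ¬ CertOK p g F := fun hc => hpr hc.1
    simp [hpr, h]

/-! ### Reading the certificate register -/

/-- `nthF j = fstF ∘ sndF^[j]`. [folklore] -/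
theorem nthF_eq_fstF_iterate (j : ℕ) (W : List Bool) : nthF j W = fstF (sndF^[j] W) := by
  induction j generalizing W with
  | zero => rfl
  | succ j ih => rw [nthF, Function.comp_apply, ih, ← Function.iterate_succ_apply]

/-- Field `j` of a string, for a unary `j`. [folklore] -/
theorem codeFP_nthF : CodeFP (pairE unE strE) strE (fun s => nthF s.1 s.2) := by
  refine ⟨HashBricks.nthItemFn, HashBricks.nthItemFn_mem_FP, fun s => ?_⟩
  obtain ⟨j, W⟩ := s
  rw [pairE_apply, Brick.nthItemFn_eq_fstF_comp_dropItemsFn, Function.comp_apply, Brick.dropItemsFn_boolPair, length_unE,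
    ← nthF_eq_fstF_iterate]
  rfl

/-- **The certificate parser is polynomial time.** [folklore] -/
theorem codeFP_parseF : CodeFP strE (rawE natE) parseF := by
  have hlen : CodeFP strE unE (fun r => (fstF r).length) := strLength.comp codeFP_fstF
  have hitem : CodeFP (pairE strE natE) natE (fun s => bitsToNat (nthF (min s.2 s.1.length) (sndF s.1))) :=
    strVal.comp (codeFP_nthF.comp ((unOfNatMin.comp ((strLength.comp (fst _ _)).pair (snd _ _))).pair (codeFP_sndF.comp (fst _ _))))
  refine ((CodeFP.map hitem).comp ((CodeFP.id strE).pair (urange.comp hlen))).congr fun r => ?_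
  dsimp only [id]
  rw [parseF]
  refine List.map_congr_left fun j hj => ?_
  rw [List.mem_range] at hj
  have h1 := length_fstF_sndF_le r
  rw [Nat.min_eq_left (by omega)]

/-! ### The classical post-processing of the discrete-logarithm subroutine -/

/-- The candidates read off the prefixes of the solver's output: `bitsToNat (out ↾ ℓ)`, `ℓ ≤ |out|`.
[folklore] -/
theorem codeFP_cands : CodeFP strE (rawE natE) (fun out => (List.range (out.length + 1)).map fun ℓ => bitsToNat (out.take ℓ)) := by
  have hitem : CodeFP (pairE strE natE) natE (fun s => bitsToNat (s.1.take (min s.2 s.1.length))) :=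
    strVal.comp (strTake.comp ((unOfNatMin.comp ((strLength.comp (fst _ _)).pair (snd _ _))).pair (fst _ _)))
  refine ((CodeFP.map hitem).comp ((CodeFP.id strE).pair (urange.comp (unSucc.comp strLength)))).congr fun out => ?_
  dsimp only [id]
  refine List.map_congr_left fun ℓ hℓ => ?_
  rw [List.mem_range] at hℓ
  rcases Nat.lt_or_ge ℓ out.length with h | h
  · rw [Nat.min_eq_left h.le]
  · rw [Nat.min_eq_right h, List.take_length, List.take_of_length_le h]

/-- Bit `i` of a binary numeral. [folklore] -/
theorem codeFP_testBit : CodeFP (pairE natE natE) bitE (fun p => p.1.testBit p.2) :=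
  (strGetDNat.comp ((strOfNat.comp (fst _ _)).pair (snd _ _))).congr fun p => by
    dsimp only
    rw [← testBit_bitsToNat_eq_getD, bitsToNat_natE]

/-- **The discrete-logarithm answer read off the solver's output**: is there a prefix candidate
`c < p − 1` with `g^c ≡ y (mod p)` (one modular exponentiation) whose bit `idx` is set? — as a
polynomial-time function of `((p, g, y), idx, out)`. [cite: Shor1997, §6] -/
theorem codeFP_dlogAny :
    CodeFP (pairE (pairE natE (pairE natE natE)) (pairE natE strE)) bitE (fun t =>
      ((List.range (t.2.2.length + 1)).map fun ℓ => bitsToNat (t.2.2.take ℓ)).any fun c =>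
        (decide (c < t.1.1 - 1) && decide (powM t.1.1 t.1.2.1 c = t.1.2.2 % t.1.1)) && c.testBit t.2.1) := by
  -- context `σ = ((p, g, y), idx)`, item `c`
  have hp : CodeFP (pairE (pairE (pairE natE (pairE natE natE)) natE) natE) natE (fun s => s.1.1.1) := (fst _ _).fst'.fst'
  have hg : CodeFP (pairE (pairE (pairE natE (pairE natE natE)) natE) natE) natE (fun s => s.1.1.2.1) := (fst _ _).fst'.snd'.fst'
  have hy : CodeFP (pairE (pairE (pairE natE (pairE natE natE)) natE) natE) natE (fun s => s.1.1.2.2) := (fst _ _).fst'.snd'.snd'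
  have hi : CodeFP (pairE (pairE (pairE natE (pairE natE natE)) natE) natE) natE (fun s => s.1.2) := (fst _ _).snd'
  have hc : CodeFP (pairE (pairE (pairE natE (pairE natE natE)) natE) natE) natE (fun s => s.2) := snd _ _
  have hitem : CodeFP (pairE (pairE (pairE natE (pairE natE natE)) natE) natE) bitE (fun s =>
      (decide (s.2 < s.1.1.1 - 1) && decide (powM s.1.1.1 s.1.1.2.1 s.2 = s.1.1.2.2 % s.1.1.1)) && s.2.testBit s.1.2) :=
    ((natLt.comp (hc.pair (natSub.comp (hp.pair (const _ 1))))).and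
      (natEq.comp ((modExp.comp (hg.pair (hc.pair hp))).pair (natMod.comp (hy.pair hp))))).and (codeFP_testBit.comp (hc.pair hi))
  have hctx : CodeFP (pairE (pairE natE (pairE natE natE)) (pairE natE strE)) (pairE (pairE natE (pairE natE natE)) natE)
      (fun t => (t.1, t.2.1)) := (fst _ _).pair (snd _ _).fst'
  have hout : CodeFP (pairE (pairE natE (pairE natE natE)) (pairE natE strE)) (rawE natE)
      (fun t => (List.range (t.2.2.length + 1)).map fun ℓ => bitsToNat (t.2.2.take ℓ)) := codeFP_cands.comp (snd _ _).snd'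
  exact ((any hitem).comp (hctx.pair hout)).congr fun _ => rfl

/-- **The scan finds the discrete logarithm.** On an instance `(p, g, y)`, if the solver's output has
`bin (ind_g y)` as a prefix, then a prefix candidate `c < p − 1` with `g^c ≡ y` exists (that prefix) and
every such candidate IS `ind_g y` (uniqueness of the discrete logarithm), so the scanned bit is bit `idx`
of `ind_g y`. [cite: Shor1997, §6] -/
theorem dlogAny_eq_testBit_dlog {p g y : ℕ} (h : IsDLogInstance p g y) (idx : ℕ) {out : List Bool}
    (hout : encodeNat (dlog p g y) <+: out) :
    (((List.range (out.length + 1)).map fun ℓ => bitsToNat (out.take ℓ)).any fun c =>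
        (decide (c < p - 1) && decide (powM p g c = y % p)) && c.testBit idx) = (dlog p g y).testBit idx := by
  have hp2 : 2 ≤ p := h.1.two_le
  have hacc : ∀ c, (decide (c < p - 1) && decide (powM p g c = y % p)) = true ↔ c ∈ dlogSolutions p g y := by
    intro c
    rw [Bool.and_eq_true, decide_eq_true_eq, decide_eq_true_eq, mem_dlogSolutions, powM, if_pos hp2]
    rfl
  rw [Bool.eq_iff_iff, List.any_eq_true]
  constructor
  · rintro ⟨c, -, hc⟩
    rw [Bool.and_eq_true] at hc
    rw [← eq_dlog h ((hacc c).1 hc.1)]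
    exact hc.2
  · intro hbit
    refine ⟨dlog p g y, ?_, ?_⟩
    · rw [List.mem_map]
      refine ⟨(encodeNat (dlog p g y)).length, List.mem_range.2 (Nat.lt_succ_of_le hout.length_le), ?_⟩
      rw [← List.prefix_iff_eq_take.1 hout]
      exact bitsToNat_encodeNat _
    · rw [Bool.and_eq_true, hacc]
      exact ⟨dlog_mem h, hbit⟩

/-! ### The classical post-processing of the factoring subroutine -/

/-- **The factoring answer read off the solver's output**: bit `idx` of `certCode (parseF out)` — for
`out` extending `certCode F₀` this is bit `idx` of `certCode F₀` (`parseF_certCode_append`), as a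
polynomial-time function of `(idx, out)`. [cite: Shor1997, §5] -/
theorem codeFP_factBit : CodeFP (pairE natE strE) bitE (fun t => (certCode (parseF t.2)).getD t.1 false) := by
  have hF : CodeFP (pairE natE strE) (rawE natE) (fun t => parseF t.2) := codeFP_parseF.comp (snd _ _)
  have hcode : CodeFP (rawE natE) strE (fun F => certCode F) :=
    ((transparent (eα := listE natE) (eβ := strE) (g := certCode) fun _ => rfl).comp (listOfRaw natE)).congr fun _ => rfl
  exact strGetDNat.comp ((hcode.comp hF).pair (fst _ _))

/-- The factoring answer on a good output is the bit of the factorisation code. [cite: Shor1997, §5] -/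
theorem factBit_of_prefix {p idx : ℕ} {out : List Bool} (hout : factCode p <+: out) :
    (certCode (parseF out)).getD idx false = (factCode p).getD idx false := by
  obtain ⟨junk, rfl⟩ := hout
  rw [factCode, parseF_certCode_append]

end VDSOracle

end Literature.Computability.Cryptography

end
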